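import Mathlib
import HarnessLib
import Summits.NavierStokesRegularity.NavierStokesRegularity.Theses.TypeILiouville
import Summits.NavierStokesRegularity.NavierStokesRegularity.Theorems.SqueezeCycleSingularZoom
import Summits.NavierStokesRegularity.NavierStokesRegularity.Theorems.SqueezeCycleExtremalBiaxialitySubcriticalOfLiouville

/-!
# `TypeILiouville.TypeIliouvilleLKillsTypeI` (stmt-NavierStokesRegularity-10662): (L) kills Type-I blow-up

The support item "(L) ⟹ a maximal Leray–Hopf classical solution from a rapidly decaying datum is not
Type I" is a corollary of three results already in the tree:

* `squeezeLiouville_of_liouvilleConjectureNS` — (L) ⟹ Liouville on the Type-I model class `𝒦_C`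
  (`SqueezeCycle.SqueezeLiouville`), by the shifted-field argument and
  `IsTypeIAncientMild.eq_zero_of_slice_const`;
* the step "a field vanishing on `t < 0` is not singular at the origin" (inlined below, as in
  `SqueezeCycle.closes`);
* `singularZoom_proof` — the PROVED shared item `SingularZoom` (stmt-10573): no singular element of
  `𝒦_C` ⟹ every Leray–Hopf classical solution from a rapidly decaying datum with the Type-I rate
  extends past `T` (Albritton–Barker 2019 §3 forward zoom; KNSS 2009 Lemma 6.1, Prop. 4.1).

A maximal solution does not extend, so under (L) it cannot carry the Type-I rate. The antecedent of
the item is (L) written out verbatim (definiens of `LiouvilleConjectureNS`). Found while calibrating the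
crux `IsobarTomography.TubeAlternative` (stmt-11739, `IsobarTomographyTubeAlternativeCalibration.lean`).
-/

-- the problem directory repeats the summit name (D-0017); core's `dupNamespace` linter fires
set_option linter.dupNamespace false

noncomputable section

namespace Summit.NavierStokesRegularity.NavierStokesRegularity.Theorems

open Set Filter Topology Function MeasureTheory
open Literature.Analysis Literature.Analysis.FluidPDE
open Summit.NavierStokesRegularity.NavierStokesRegularity.Theses

/-- **(L) ⟹ no Type-I blow-up in the Clay class** (the Type-I extension statement, = item
`TypeICertificateLadder.NoTypeIBlowup` verbatim): (L) gives Liouville on `𝒦_C`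
(`squeezeLiouville_of_liouvilleConjectureNS`), hence no singular Type-I model, hence extension past
`T` by the proved `SingularZoom`. [cite: KochNadirashviliSereginSverak2009, §1 conjecture (L) and §6 Prop. 6.1 (arXiv:0709.3599)] -/
theorem typeIExtends_of_liouvilleConjectureNS
    (hL : ∀ u : ℝ → EuclideanSpace ℝ (Fin 3) → EuclideanSpace ℝ (Fin 3),
      IsBoundedAncientMildSolution 1 u → (∀ t < 0, AEStronglyMeasurable (u t) volume) →
      ∀ t < 0, ∃ b : EuclideanSpace ℝ (Fin 3), u t =ᵐ[volume] fun _ => b) :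
    ∀ (ν T : ℝ), 0 < ν → 0 < T →
    ∀ (u : ℝ → EuclideanSpace ℝ (Fin 3) → EuclideanSpace ℝ (Fin 3))
      (p : ℝ → EuclideanSpace ℝ (Fin 3) → ℝ),
    IsClassicalNSSolutionOn (Set.Ico 0 T) ν 0 u p → IsLerayHopfOn T ν 0 (u 0) u →
    HasRapidSpatialDecay (u 0) → IsTypeIBlowup u T → HasSmoothExtensionPast ν 0 u T := by
  have hSL : SqueezeCycle.SqueezeLiouville := squeezeLiouville_of_liouvilleConjectureNS hL
  refine singularZoom_proof ?_
  intro C v hv hsing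
  obtain ⟨t, ht, x, -, hlt⟩ := hsing 1 one_pos 0
  have h0 : v t x = 0 := hSL C v hv t ht.2 x
  rw [h0, norm_zero] at hlt
  exact lt_irrefl _ hlt

/-- **Item `TypeILiouville.TypeIliouvilleLKillsTypeI` (stmt-NavierStokesRegularity-10662) holds**:
assuming (L) (the antecedent, verbatim item `TypeIliouvilleL` = definiens of `LiouvilleConjectureNS`),
a maximal smooth solution with finite lifespan `T` which is Leray–Hopf from a rapidly decaying datum
is not Type I at `T` — otherwise `typeIExtends_of_liouvilleConjectureNS` extends it past `T`,
contradicting maximality. [cite: KochNadirashviliSereginSverak2009, §1 and §6 Prop. 6.1 (arXiv:0709.3599)] -/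
theorem typeILiouville_typeIliouvilleLKillsTypeI_proof :
    Summit.NavierStokesRegularity.NavierStokesRegularity.Theses.TypeILiouville.TypeIliouvilleLKillsTypeI := by
  unfold Summit.NavierStokesRegularity.NavierStokesRegularity.Theses.TypeILiouville.TypeIliouvilleLKillsTypeI
  intro hL ν T hν hT u p hmax hLH hdec hI
  exact hmax.2 (typeIExtends_of_liouvilleConjectureNS hL ν T hν hT u p hmax.1 hLH hdec hI)

end Summit.NavierStokesRegularity.NavierStokesRegularity.Theorems

end
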